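import Summits.CriticalPhenomena.PercolationContinuityZ3.Theorems.PercNearOneGluingNoHeavyLowerTailKnQuestion8CoefficientwiseIsland
import HarnessLib

/-!
# Islands II: the maximal island and the island correspondence (Lemma B) — prim-lf-2 gen 36, ISLAND FACTORISATION §2

Support file (`--supports stmt-CriticalPhenomena-4575`, closed), prover `prim-lf-2` (gen 36).  No definitions, no named facts,
      no sorries; standard axioms.
Memo `prim-lf-2/CW-RESIDUE-gen36.md` §2.  Companion of …CoefficientwiseIsland (Lemma A, fixed-island factorisation).

Setting: finite multigraph `ends : ι
      → Sym2 V`, a vertex finset `Vs` (islands are taken inside `Vs`), edge set `E`, root `x ∈ Vs`, point `w`, colouring `s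
      ⊆ E` (red) / `E \ s` (blue);
`C(t) = openCluster (ends '' t) x`.  For `Y : Finset V` with `x ∈ Y`, `w ∉ Y`: BOUNDARY vertex = `t ∈ Y \ {x}` with an `E`-neighbour outside `Y`;
`Y` is an ISLAND of `s` if every boundary vertex lies in `C(s|Y) ∩ C((E \ s)|Y)` (`·|Y` = the edges with both ends in `Y`).
* `Coefficientwise.island_union` — islands are closed under `∪`;
* `Coefficientwise.island_sup` / `subset_islandSup` / `mem_islandSup` — the union `Y_max(s)` of all islands is an
  island containing `x`, avoiding `w`, and containing every island `⊆ Vs` (spelled `Vs.filter (∃ island ∋ v)`); `islandSup_eq_iff` — `Y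
        = Y_max(s)` iff `Y` is an island and every island is `⊆ Y`
  iff `Y` is an island and NO island strictly contains `Y`;
* `Coefficientwise.island_iff_quotient_of_subset` — **Lemma B**: if `Y` is an island of `s` and `Y ⊆ Y'`, then `Y'` is an island of `s` iff `Y'` is an
  island of the QUOTIENT colouring (`s ∪ E_Y` red, `(E \ s)
        ∪ E_Y` blue — all edges inside `Y` given to both colours): the islands above `Y` are the islands
  of `G/Y`.  Hence `Y = Y_max(s)` iff `Y` is an island of `s` and the quotient colouring is PRIME (no island of `G/Y` other than the collapsed root).
The assembly `P(G) = Σ_Y N_isl(Y) · R(G/Y)` is …CoefficientwiseIslandFactorisation.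
[cite: KozmaNitzan2024, Questions 8–9 (§5.5 p. 36) (context: the Question-8 pocket covariance programme)]
-/

namespace Summit.CriticalPhenomena.PercolationContinuityZ3.Theorems

open Finset Literature.Probability.Percolation

namespace Coefficientwise

variable {ι V : Type*}

open Classical in
/-- Monotonicity of the 'inside `Y`' cluster in `Y`. [cite: KozmaNitzan2024, §5.5 (context only; folklore)] -/
theorem openCluster_filter_inside_mono (ends : ι → Sym2 V) (c : Finset ι) (x : V) {Y Y' : Finset V} (hYY : Y ⊆ Y') :
    openCluster (ends '' (↑(c.filter (fun i => ∀ y ∈ ends i, y ∈ Y)) : Set ι)) x ⊆ openCluster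
          (ends '' (↑(c.filter (fun i => ∀ y ∈ ends i, y ∈ Y')) : Set ι)) x := by
  refine openCluster_image_mono ends ?_ x
  intro i hi
  rw [Finset.mem_filter] at hi ⊢
  exact ⟨hi.1, fun y hy => hYY (hi.2 y hy)⟩

open Classical in
/-- **Islands are closed under union.** [cite: KozmaNitzan2024, §5.5 (context only)] -/
theorem island_union (ends : ι → Sym2 V) (E s : Finset ι) (x : V) (Y₁ Y₂ : Finset V)
    (h₁ : (∀ t ∈ Y₁, t ≠ x → (∃ i ∈ E, ∃ t', ends i = s(t, t') ∧ t' ∉ Y₁) →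
          t ∈ openCluster (ends '' (↑(s.filter (fun i => ∀ y ∈ ends i, y ∈ Y₁)) : Set ι)) x ∧ t ∈ openCluster
                (ends '' (↑((E \ s).filter (fun i => ∀ y ∈ ends i, y ∈ Y₁)) : Set ι)) x))
    (h₂ : (∀ t ∈ Y₂, t ≠ x → (∃ i ∈ E, ∃ t', ends i = s(t, t') ∧ t' ∉ Y₂) →
          t ∈ openCluster (ends '' (↑(s.filter (fun i => ∀ y ∈ ends i, y ∈ Y₂)) : Set ι)) x ∧ t ∈ openCluster
                (ends '' (↑((E \ s).filter (fun i => ∀ y ∈ ends i, y ∈ Y₂)) : Set ι)) x)) :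
    (∀ t ∈ (Y₁ ∪ Y₂), t ≠ x → (∃ i ∈ E, ∃ t', ends i = s(t, t') ∧ t' ∉ (Y₁ ∪ Y₂)) →
          t ∈ openCluster (ends '' (↑(s.filter (fun i => ∀ y ∈ ends i, y ∈ (Y₁ ∪ Y₂))) : Set ι)) x ∧ t ∈ openCluster
                (ends '' (↑((E \ s).filter (fun i => ∀ y ∈ ends i, y ∈ (Y₁ ∪ Y₂))) : Set ι)) x) := by
  intro t ht htx hbd
  obtain ⟨i, hi, t', he, ht'⟩ := hbd
  rw [Finset.mem_union, not_or] at ht'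
  rcases Finset.mem_union.mp ht with ht1 | ht2
  · have h := h₁ t ht1 htx ⟨i, hi, t', he, ht'.1⟩
    exact ⟨openCluster_filter_inside_mono ends s x Finset.subset_union_left h.1,
      openCluster_filter_inside_mono ends (E \ s) x Finset.subset_union_left h.2⟩
  · have h := h₂ t ht2 htx ⟨i, hi, t', he, ht'.2⟩
    exact ⟨openCluster_filter_inside_mono ends s x Finset.subset_union_right h.1,
      openCluster_filter_inside_mono ends (E \ s) x Finset.subset_union_right h.2⟩


open Classical in
/-- Every island (containing `x`, avoiding `w`) lies in the union of islands `Y_max(s)`. [cite: KozmaNitzan2024, §5.5 (context only)] -/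
theorem subset_islandSup (ends : ι → Sym2 V) (E s : Finset ι) (x w : V) (Vs Y : Finset V) (hYV : Y ⊆ Vs) (hxY : x ∈ Y) (hwY : w ∉ Y)
    (hY : (∀ t ∈ Y, t ≠ x → (∃ i ∈ E, ∃ t', ends i = s(t, t') ∧ t' ∉ Y) →
          t ∈ openCluster (ends '' (↑(s.filter (fun i => ∀ y ∈ ends i, y ∈ Y)) : Set ι)) x ∧ t ∈ openCluster
                (ends '' (↑((E \ s).filter (fun i => ∀ y ∈ ends i, y ∈ Y)) : Set ι)) x)) :
    Y ⊆ (Vs.filter (fun v : V => ∃ Y : Finset V, Y ⊆ Vs ∧ x ∈ Y ∧ w ∉ Y ∧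
        (∀ t ∈ Y, t ≠ x → (∃ i ∈ E, ∃ t', ends i = s(t, t') ∧ t' ∉ Y) →
          t ∈ openCluster (ends '' (↑(s.filter (fun i => ∀ y ∈ ends i, y ∈ Y)) : Set ι)) x ∧ t ∈ openCluster
                (ends '' (↑((E \ s).filter (fun i => ∀ y ∈ ends i, y ∈ Y)) : Set ι)) x) ∧ v ∈ Y)) := by
  intro v hv
  rw [Finset.mem_filter]
  exact ⟨hYV hv, Y, hYV, hxY, hwY, hY, hv⟩

open Classical in
/-- `x ∈ Y_max(s)` and `w ∉ Y_max(s)`. [cite: KozmaNitzan2024, §5.5 (context only)] -/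
theorem mem_islandSup (ends : ι → Sym2 V) (E s : Finset ι) (x w : V) (Vs : Finset V) (hxV : x ∈ Vs) (hwx : w ≠ x) :
    x ∈ (Vs.filter (fun v : V => ∃ Y : Finset V, Y ⊆ Vs ∧ x ∈ Y ∧ w ∉ Y ∧
        (∀ t ∈ Y, t ≠ x → (∃ i ∈ E, ∃ t', ends i = s(t, t') ∧ t' ∉ Y) →
          t ∈ openCluster (ends '' (↑(s.filter (fun i => ∀ y ∈ ends i, y ∈ Y)) : Set ι)) x ∧ t ∈ openCluster
                (ends '' (↑((E \ s).filter (fun i => ∀ y ∈ ends i, y ∈ Y)) : Set ι)) x) ∧ v ∈ Y)) ∧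
    w ∉ (Vs.filter (fun v : V => ∃ Y : Finset V, Y ⊆ Vs ∧ x ∈ Y ∧ w ∉ Y ∧
        (∀ t ∈ Y, t ≠ x → (∃ i ∈ E, ∃ t', ends i = s(t, t') ∧ t' ∉ Y) →
          t ∈ openCluster (ends '' (↑(s.filter (fun i => ∀ y ∈ ends i, y ∈ Y)) : Set ι)) x ∧ t ∈ openCluster
                (ends '' (↑((E \ s).filter (fun i => ∀ y ∈ ends i, y ∈ Y)) : Set ι)) x) ∧ v ∈ Y)) := by
  constructor
  · refine subset_islandSup ends E s x w Vs {x} (Finset.singleton_subset_iff.mpr hxV) (Finset.mem_singleton_self x) ?_ ?_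
      (Finset.mem_singleton_self x)
    · rw [Finset.mem_singleton]; exact hwx
    · intro t ht htx _
      exact absurd (Finset.mem_singleton.mp ht) htx
  · intro hw
    rw [Finset.mem_filter] at hw
    obtain ⟨-, Y, -, -, hwY, -, hwY'⟩ := hw
    exact hwY hwY'

open Classical in
/-- **The union of all islands is an island.** [cite: KozmaNitzan2024, §5.5 (context only)] -/
theorem island_sup (ends : ι → Sym2 V) (E s : Finset ι) (x w : V) (Vs : Finset V) :
    (∀ t ∈ (Vs.filter (fun v : V => ∃ Y : Finset V, Y ⊆ Vs ∧ x ∈ Y ∧ w ∉ Y ∧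
        (∀ t ∈ Y, t ≠ x → (∃ i ∈ E, ∃ t', ends i = s(t, t') ∧ t' ∉ Y) →
          t ∈ openCluster (ends '' (↑(s.filter (fun i => ∀ y ∈ ends i, y ∈ Y)) : Set ι)) x ∧ t ∈ openCluster
                (ends '' (↑((E \ s).filter (fun i => ∀ y ∈ ends i, y ∈ Y)) : Set ι)) x) ∧ v ∈ Y)), t ≠ x → (∃ i ∈ E, ∃ t', ends i = s(t, t')
                ∧ t' ∉ (Vs.filter (fun v : V => ∃ Y : Finset V, Y ⊆ Vs ∧ x ∈ Y ∧ w ∉ Y ∧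
        (∀ t ∈ Y, t ≠ x → (∃ i ∈ E, ∃ t', ends i = s(t, t') ∧ t' ∉ Y) →
          t ∈ openCluster (ends '' (↑(s.filter (fun i => ∀ y ∈ ends i, y ∈ Y)) : Set ι)) x ∧ t ∈ openCluster
                (ends '' (↑((E \ s).filter (fun i => ∀ y ∈ ends i, y ∈ Y)) : Set ι)) x) ∧ v ∈ Y))) →
          t ∈ openCluster (ends '' (↑(s.filter (fun i => ∀ y ∈ ends i, y ∈ (Vs.filter (fun v : V => ∃ Y : Finset V, Y ⊆ Vs ∧ x ∈ Y ∧ w ∉ Y ∧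
        (∀ t ∈ Y, t ≠ x → (∃ i ∈ E, ∃ t', ends i = s(t, t') ∧ t' ∉ Y) →
          t ∈ openCluster (ends '' (↑(s.filter (fun i => ∀ y ∈ ends i, y ∈ Y)) : Set ι)) x ∧ t ∈ openCluster
                (ends '' (↑((E \ s).filter (fun i => ∀ y ∈ ends i, y ∈ Y)) : Set ι)) x) ∧ v ∈ Y)))) : Set ι)) x ∧ t ∈ openCluster
                (ends '' (↑((E \ s).filter (fun i => ∀ y ∈ ends i, y ∈ (Vs.filter (fun v : V => ∃ Y : Finset V, Y ⊆ Vs ∧ x ∈ Y ∧ w ∉ Y ∧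
        (∀ t ∈ Y, t ≠ x → (∃ i ∈ E, ∃ t', ends i = s(t, t') ∧ t' ∉ Y) →
          t ∈ openCluster (ends '' (↑(s.filter (fun i => ∀ y ∈ ends i, y ∈ Y)) : Set ι)) x ∧ t ∈ openCluster
                (ends '' (↑((E \ s).filter (fun i => ∀ y ∈ ends i, y ∈ Y)) : Set ι)) x) ∧ v ∈ Y)))) : Set ι)) x) := by
  intro t ht htx hbd
  rw [Finset.mem_filter] at ht
  obtain ⟨-, Y, hYV, hxY, hwY, hY, htY⟩ := ht
  obtain ⟨i, hi, t', he, ht'⟩ := hbd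
  have hsub := subset_islandSup ends E s x w Vs Y hYV hxY hwY hY
  have ht'Y : t' ∉ Y := fun h => ht' (hsub h)
  have h := hY t htY htx ⟨i, hi, t', he, ht'Y⟩
  exact ⟨openCluster_filter_inside_mono ends s x hsub h.1, openCluster_filter_inside_mono ends (E \ s) x hsub h.2⟩

open Classical in
/-- **Characterisation of the maximal island.**  For `w ≠ x`: `Y
      = Y_max(s)` iff `x ∈ Y`, `w ∉ Y`, `Y` is an island and no island (containing `x`, avoiding `w`)
strictly contains `Y`. [cite: KozmaNitzan2024, §5.5 (context only)] -/
theorem islandSup_eq_iff (ends : ι → Sym2 V) (E s : Finset ι) (x w : V) (Vs : Finset V) (hxV : x ∈ Vs) (hwx : w ≠ x) (Y : Finset V) :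
    (Vs.filter (fun v : V => ∃ Y : Finset V, Y ⊆ Vs ∧ x ∈ Y ∧ w ∉ Y ∧
        (∀ t ∈ Y, t ≠ x → (∃ i ∈ E, ∃ t', ends i = s(t, t') ∧ t' ∉ Y) →
          t ∈ openCluster (ends '' (↑(s.filter (fun i => ∀ y ∈ ends i, y ∈ Y)) : Set ι)) x ∧ t ∈ openCluster
                (ends '' (↑((E \ s).filter (fun i => ∀ y ∈ ends i, y ∈ Y)) : Set ι)) x) ∧ v ∈ Y)) = Y ↔
    (Y ⊆ Vs ∧ x ∈ Y ∧ w ∉ Y ∧ (∀ t ∈ Y, t ≠ x → (∃ i ∈ E, ∃ t', ends i = s(t, t') ∧ t' ∉ Y) →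
          t ∈ openCluster (ends '' (↑(s.filter (fun i => ∀ y ∈ ends i, y ∈ Y)) : Set ι)) x ∧ t ∈ openCluster
                (ends '' (↑((E \ s).filter (fun i => ∀ y ∈ ends i, y ∈ Y)) : Set ι)) x) ∧
      ∀ Y' : Finset V, Y ⊆ Y' → Y ≠ Y' → Y' ⊆ Vs → w ∉ Y' →
        ¬ (∀ t ∈ Y', t ≠ x → (∃ i ∈ E, ∃ t', ends i = s(t, t') ∧ t' ∉ Y') →
          t ∈ openCluster (ends '' (↑(s.filter (fun i => ∀ y ∈ ends i, y ∈ Y')) : Set ι)) x ∧ t ∈ openCluster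
                (ends '' (↑((E \ s).filter (fun i => ∀ y ∈ ends i, y ∈ Y')) : Set ι)) x)) := by
  have hmem := mem_islandSup ends E s x w Vs hxV hwx
  have hsup := island_sup ends E s x w Vs
  have hsupV : (Vs.filter (fun v : V => ∃ Y : Finset V, Y ⊆ Vs ∧ x ∈ Y ∧ w ∉ Y ∧
        (∀ t ∈ Y, t ≠ x → (∃ i ∈ E, ∃ t', ends i = s(t, t') ∧ t' ∉ Y) →
          t ∈ openCluster (ends '' (↑(s.filter (fun i => ∀ y ∈ ends i, y ∈ Y)) : Set ι)) x ∧ t ∈ openCluster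
                (ends '' (↑((E \ s).filter (fun i => ∀ y ∈ ends i, y ∈ Y)) : Set ι)) x) ∧ v ∈ Y)) ⊆ Vs := Finset.filter_subset _ _
  constructor
  · intro hY
    subst hY
    refine ⟨hsupV, hmem.1, hmem.2, hsup, ?_⟩
    intro Y' hYY' hne hY'V hwY' hY'
    exact hne (Finset.Subset.antisymm hYY' (subset_islandSup ends E s x w Vs Y' hY'V (hYY' hmem.1) hwY' hY'))
  · rintro ⟨hYV, hxY, hwY, hY, hmax⟩
    have h1 : Y ⊆ (Vs.filter (fun v : V => ∃ Y : Finset V, Y ⊆ Vs ∧ x ∈ Y ∧ w ∉ Y ∧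
        (∀ t ∈ Y, t ≠ x → (∃ i ∈ E, ∃ t', ends i = s(t, t') ∧ t' ∉ Y) →
          t ∈ openCluster (ends '' (↑(s.filter (fun i => ∀ y ∈ ends i, y ∈ Y)) : Set ι)) x ∧ t ∈ openCluster
                (ends '' (↑((E \ s).filter (fun i => ∀ y ∈ ends i, y ∈ Y)) : Set ι)) x) ∧ v ∈ Y)) := subset_islandSup ends E s x w Vs Y hYV hxY hwY hY
    by_contra hne
    have hU := island_union ends E s x Y _ hY hsup
    refine hmax (Y ∪ (Vs.filter (fun v : V => ∃ Y : Finset V, Y ⊆ Vs ∧ x ∈ Y ∧ w ∉ Y ∧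
        (∀ t ∈ Y, t ≠ x → (∃ i ∈ E, ∃ t', ends i = s(t, t') ∧ t' ∉ Y) →
          t ∈ openCluster (ends '' (↑(s.filter (fun i => ∀ y ∈ ends i, y ∈ Y)) : Set ι)) x ∧ t ∈ openCluster
                (ends '' (↑((E \ s).filter (fun i => ∀ y ∈ ends i, y ∈ Y)) : Set ι)) x)
                ∧ v ∈ Y))) Finset.subset_union_left ?_ (Finset.union_subset hYV hsupV) ?_ hU
    · intro heq
      apply hne
      refine Finset.Subset.antisymm ?_ h1
      have : (Vs.filter (fun v : V => ∃ Y : Finset V, Y ⊆ Vs ∧ x ∈ Y ∧ w ∉ Y ∧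
        (∀ t ∈ Y, t ≠ x → (∃ i ∈ E, ∃ t', ends i = s(t, t') ∧ t' ∉ Y) →
          t ∈ openCluster (ends '' (↑(s.filter (fun i => ∀ y ∈ ends i, y ∈ Y)) : Set ι)) x ∧ t ∈ openCluster
                (ends '' (↑((E \ s).filter (fun i => ∀ y ∈ ends i, y ∈ Y)) : Set ι)) x) ∧ v ∈ Y)) ⊆ Y ∪ (Vs.filter (fun v : V => ∃ Y : Finset V, Y
                ⊆ Vs ∧ x ∈ Y ∧ w ∉ Y ∧
        (∀ t ∈ Y, t ≠ x → (∃ i ∈ E, ∃ t', ends i = s(t, t') ∧ t' ∉ Y) →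
          t ∈ openCluster (ends '' (↑(s.filter (fun i => ∀ y ∈ ends i, y ∈ Y)) : Set ι)) x ∧ t ∈ openCluster
                (ends '' (↑((E \ s).filter (fun i => ∀ y ∈ ends i, y ∈ Y)) : Set ι)) x) ∧ v ∈ Y)) := Finset.subset_union_right
      rw [← heq] at this
      exact this
    · rw [Finset.mem_union, not_or]
      exact ⟨hwY, hmem.2⟩

open Classical in
/-- **Lemma B (island correspondence).**  If `Y` is an island of `s ⊆ E` and `Y ⊆ Y'` (`x ∈ Y`),
      then `Y'` is an island of `s` iff it is an island of the
quotient colouring `(s ∪ E_Y, (E \ s) ∪ E_Y)`, `E_Y` = the edges inside `Y`.  [cite: KozmaNitzan2024, §5.5 (context only)] -/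
theorem island_iff_quotient_of_subset (ends : ι → Sym2 V) (E s : Finset ι) (hs : s ⊆ E) (x : V) (Y Y' : Finset V) (hxY : x ∈ Y) (hYY : Y ⊆ Y')
    (hY : (∀ t ∈ Y, t ≠ x → (∃ i ∈ E, ∃ t', ends i = s(t, t') ∧ t' ∉ Y) →
          t ∈ openCluster (ends '' (↑(s.filter (fun i => ∀ y ∈ ends i, y ∈ Y)) : Set ι)) x ∧ t ∈ openCluster
                (ends '' (↑((E \ s).filter (fun i => ∀ y ∈ ends i, y ∈ Y)) : Set ι)) x)) :
    (∀ t ∈ Y', t ≠ x → (∃ i ∈ E, ∃ t', ends i = s(t, t') ∧ t' ∉ Y') →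
          t ∈ openCluster (ends '' (↑(s.filter (fun i => ∀ y ∈ ends i, y ∈ Y')) : Set ι)) x ∧ t ∈ openCluster
                (ends '' (↑((E \ s).filter (fun i => ∀ y ∈ ends i, y ∈ Y')) : Set ι)) x) ↔
    (∀ t ∈ Y', t ≠ x → (∃ i ∈ E, ∃ t', ends i = s(t, t') ∧ t' ∉ Y') →
          t ∈ openCluster (ends '' (↑((s ∪ E.filter (fun i => ∀ y ∈ ends i, y ∈ Y)).filter (fun i => ∀ y ∈ ends i, y ∈ Y')) : Set ι)) x
                ∧ t ∈ openCluster (ends '' (↑(((E \ s)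
                ∪ E.filter (fun i => ∀ y ∈ ends i, y ∈ Y)).filter (fun i => ∀ y ∈ ends i, y ∈ Y')) : Set ι)) x) := by
  set EY : Finset ι := E.filter (fun i => ∀ y ∈ ends i, y ∈ Y) with hEY
  -- the restricted graph `E' = E|Y'` and the two restricted colours
  set E' : Finset ι := E.filter (fun i => ∀ y ∈ ends i, y ∈ Y') with hE'
  -- one-colour transfer through Lemma A (outside form) inside `G[Y']`
  have transfer : ∀ c : Finset ι, c ⊆ E →
      (∀ t ∈ Y, t ≠ x → (∃ i ∈ E, ∃ t', ends i = s(t, t') ∧ t' ∉ Y) → t ∈ openCluster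
            (ends '' (↑(c.filter (fun i => ∀ y ∈ ends i, y ∈ Y)) : Set ι)) x) →
      ∀ t, t ∉ Y → (t ∈ openCluster (ends '' (↑(c.filter (fun i => ∀ y ∈ ends i, y ∈ Y')) : Set ι)) x ↔
        t ∈ openCluster (ends '' (↑((c ∪ E.filter (fun i => ∀ y ∈ ends i, y ∈ Y)).filter (fun i => ∀ y ∈ ends i, y ∈ Y')) : Set ι)) x) := by
    intro c hcE hcI t htY
    -- apply Lemma A in the graph `E'` with colour `c' = c|Y'` and island `↑Y`
    have hc'E' : c.filter (fun i => ∀ y ∈ ends i, y ∈ Y') ⊆ E' := by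
      intro i hi; rw [Finset.mem_filter] at hi ⊢; exact ⟨hcE hi.1, hi.2⟩
    have hIsl : ∀ t₂ ∈ (↑Y : Set V), t₂ ≠ x → (∃ i ∈ E', ∃ t', ends i = s(t₂, t') ∧ t' ∉ (↑Y : Set V)) →
        t₂ ∈ openCluster (ends '' (↑((c.filter (fun i => ∀ y ∈ ends i, y ∈ Y')).filter (fun i => ∀ y ∈ ends i, y ∈ (↑Y : Set V))) : Set ι)) x := by
      intro t₂ ht₂ ht₂x hbd
      obtain ⟨i, hi, t', he, ht'⟩ := hbd
      have hiE : i ∈ E := (Finset.mem_filter.mp hi).1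
      have h := hcI t₂ (Finset.mem_coe.mp ht₂) ht₂x ⟨i, hiE, t', he, fun h => ht' (Finset.mem_coe.mpr h)⟩
      refine openCluster_image_mono ends ?_ x h
      intro j hj
      rw [Finset.mem_filter] at hj
      rw [Finset.mem_filter, Finset.mem_filter]
      exact ⟨⟨hj.1, fun y hy => hYY (hj.2 y hy)⟩, fun y hy => Finset.mem_coe.mpr (hj.2 y hy)⟩
    have hA := mem_openCluster_iff_union_of_island ends E' (c.filter (fun i => ∀ y ∈ ends i,
          y ∈ Y')) hc'E' x (↑Y : Set V) (Finset.mem_coe.mpr hxY) hIsl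
      (v := t) (fun h => htY (Finset.mem_coe.mp h))
    -- identify the edge sets
    have e : c.filter (fun i => ∀ y ∈ ends i, y ∈ Y') ∪ E'.filter (fun i => ∀ y ∈ ends i, y ∈ (↑Y : Set V)) =
        (c ∪ E.filter (fun i => ∀ y ∈ ends i, y ∈ Y)).filter (fun i => ∀ y ∈ ends i, y ∈ Y') := by
      ext i
      simp only [Finset.mem_union, Finset.mem_filter, hE', Finset.mem_coe]
      constructor
      · rintro (⟨hic, hiY'⟩ | ⟨⟨hiE, -⟩, hiY⟩)
        · exact ⟨Or.inl hic, hiY'⟩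
        · exact ⟨Or.inr ⟨hiE, hiY⟩, fun y hy => hYY (hiY y hy)⟩
      · rintro ⟨hic | ⟨hiE, hiY⟩, hiY'⟩
        · exact Or.inl ⟨hic, hiY'⟩
        · exact Or.inr ⟨⟨hiE, hiY'⟩, hiY⟩
    rw [e] at hA
    exact hA
  have redT := transfer s hs (fun t ht htx hbd => (hY t ht htx hbd).1)
  have blueT := transfer (E \ s) Finset.sdiff_subset (fun t ht htx hbd => (hY t ht htx hbd).2)
  -- boundary vertices of `Y'` inside `Y` are boundary vertices of `Y` and satisfy both sides
  have inside : ∀ t ∈ Y, t ≠ x → (∃ i ∈ E, ∃ t', ends i = s(t, t') ∧ t' ∉ Y') →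
      (t ∈ openCluster (ends '' (↑(s.filter (fun i => ∀ y ∈ ends i, y ∈ Y')) : Set ι)) x ∧ t ∈ openCluster
            (ends '' (↑((E \ s).filter (fun i => ∀ y ∈ ends i, y ∈ Y')) : Set ι)) x) ∧
      (t ∈ openCluster (ends '' (↑((s ∪ E.filter (fun i => ∀ y ∈ ends i, y ∈ Y)).filter (fun i => ∀ y ∈ ends i, y ∈ Y')) : Set ι)) x ∧
       t ∈ openCluster (ends '' (↑(((E \ s) ∪ E.filter (fun i => ∀ y ∈ ends i, y ∈ Y)).filter (fun i => ∀ y ∈ ends i, y ∈ Y')) : Set ι)) x) := by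
    intro t ht htx hbd
    obtain ⟨i, hi, t', he, ht'⟩ := hbd
    have h := hY t ht htx ⟨i, hi, t', he, fun h => ht' (hYY h)⟩
    have m1 : s.filter (fun i => ∀ y ∈ ends i, y ∈ Y) ⊆ s.filter (fun i => ∀ y ∈ ends i, y ∈ Y') := by
      intro j hj; rw [Finset.mem_filter] at hj ⊢; exact ⟨hj.1, fun y hy => hYY (hj.2 y hy)⟩
    have m2 : (E \ s).filter (fun i => ∀ y ∈ ends i, y ∈ Y) ⊆ (E \ s).filter (fun i => ∀ y ∈ ends i, y ∈ Y') := by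
      intro j hj; rw [Finset.mem_filter] at hj ⊢; exact ⟨hj.1, fun y hy => hYY (hj.2 y hy)⟩
    have m3 : s.filter (fun i => ∀ y ∈ ends i, y ∈ Y) ⊆ (s ∪ E.filter (fun i => ∀ y ∈ ends i, y ∈ Y)).filter (fun i => ∀ y ∈ ends i, y ∈ Y') := by
      intro j hj; rw [Finset.mem_filter] at hj; rw [Finset.mem_filter, Finset.mem_union]
      exact ⟨Or.inl hj.1, fun y hy => hYY (hj.2 y hy)⟩
    have m4 : (E \ s).filter (fun i => ∀ y ∈ ends i, y ∈ Y) ⊆ ((E \ s)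
          ∪ E.filter (fun i => ∀ y ∈ ends i, y ∈ Y)).filter (fun i => ∀ y ∈ ends i, y ∈ Y') := by
      intro j hj; rw [Finset.mem_filter] at hj; rw [Finset.mem_filter, Finset.mem_union]
      exact ⟨Or.inl hj.1, fun y hy => hYY (hj.2 y hy)⟩
    exact ⟨⟨openCluster_image_mono ends m1 x h.1, openCluster_image_mono ends m2 x h.2⟩,
      ⟨openCluster_image_mono ends m3 x h.1, openCluster_image_mono ends m4 x h.2⟩⟩
  constructor
  · intro h t ht htx hbd
    by_cases htY : t ∈ Y
    · exact (inside t htY htx hbd).2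
    · have h' := h t ht htx hbd
      exact ⟨(redT t htY).mp h'.1, (blueT t htY).mp h'.2⟩
  · intro h t ht htx hbd
    by_cases htY : t ∈ Y
    · exact (inside t htY htx hbd).1
    · have h' := h t ht htx hbd
      exact ⟨(redT t htY).mpr h'.1, (blueT t htY).mpr h'.2⟩

end Coefficientwise

end Summit.CriticalPhenomena.PercolationContinuityZ3.Theorems
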